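import Summits.QuantumFields.QCD.Theorems.TipPricing.Negative.ReflectionSimilarity
import Literature.MathematicalPhysics.QuantumFieldTheory.SpectralDefectDensity
import Literature.MathematicalPhysics.QuantumFieldTheory.SpeciesTimeReflection

/-!
# Negative lemmas for the crux `TipPricing` (item stmt-QuantumFields-8967), IVb: the SIGNED form of
# TIGHT is false for every witness (time-reflection symmetry)

Route `SpectralDefectExtinction` (QCD), crux `TipPricing : TipNoBinding → WegnerEstimate → WindowExtinction`.
Refuter file (cdisprove seat, cycle 2): sorry-free, no definitions, no positive route-item conclusion.
Certified copy of §10 (second half) of `Summits/QuantumFields/QCD/Cruxes/TipPricing/Disproof.lean`, on top of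
`Negative/ReflectionSimilarity.lean` (index reversal `n₋(H_W(Θ'U,m)) = n₊(H_W(U,m))`, `det` invariance).

* Measure side: the tree's `measurePreserving_negReflect_wilsonMeasure` / `wilsonMeasure_map_negReflect_eq`
  (`Literature/MathematicalPhysics/QuantumFieldTheory/SpeciesTimeReflection.lean`: `Θ'` preserves the Wilson measure on
  EVERY torus, no parity assumption — review of p81408; the duplicated local copies are gone).
* `integral_nonpos_of_reflection` (abstract), `negCount_add_posCount_le` (`n₋ + n₊ ≤ 12S⁴`),
  `signedIndex_integral_nonpos` (`E₊[n₋ − 6S⁴] ≤ 0` against any `∏|det D_W|` weight, integrable or not), and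
  `signedTight_false`: the TIGHT clause of `WindowExtinction` with the absolute value dropped fails at EVERY `k`
  for every regularisation, mass tuple and probe.  So the `|·|` is essential: TIGHT is an anti-concentration
  statement about a reflection-antisymmetric integer fluctuation (mean `≤ 0`, mean modulus `≥ 1`).

References: Osterwalder–Seiler, Ann. Phys. 110 (1978) 440, §2; Lüscher, Comm. Math. Phys. 54 (1977) 283;
Edwards–Heller–Narayanan, Nucl. Phys. B 535 (1998) 403.
-/

noncomputable section

namespace Summit.QuantumFields.QCD.Theorems.TipPricing.Negative

open MeasureTheory
open Literature.MathematicalPhysics.QuantumFieldTheory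
open Literature.MathematicalPhysics.QuantumFieldTheory.WilsonRP
open Literature.MathematicalPhysics.QuantumFieldTheory.WilsonSiteRP



/-! ## The signed index has non-positive phase-quenched mean: signed TIGHT fails for every witness -/

section SignedTight

open Literature.MathematicalPhysics.QuantumLattice Literature.Probability.LatticeModels Matrix
open Summit.QuantumFields.QCD.Theses.SpectralDefectExtinction

/-- **Abstract reflection argument.**  If a measure-preserving measurable embedding `R` turns `f`
into `g` (`f ∘ R = g`) and `f + g ≤ 0` pointwise, then `∫ f ≤ 0` (no measurability of `f` assumed: a
non-integrable `f` has Bochner integral `0`). -/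
theorem integral_nonpos_of_reflection {α : Type*} [MeasurableSpace α] {μ : Measure α} {R : α → α}
    (hR : MeasurePreserving R μ μ) (hRe : MeasurableEmbedding R) (f g : α → ℝ)
    (hfg : ∀ x, f (R x) = g x) (hsum : ∀ x, f x + g x ≤ 0) : ∫ x, f x ∂μ ≤ 0 := by
  by_cases hfi : Integrable f μ
  · have hcomp : Integrable (fun x => f (R x)) μ := (hR.integrable_comp_emb hRe).mpr hfi
    have hgi : Integrable g μ := hcomp.congr (ae_of_all _ hfg)
    have h1 : ∫ x, g x ∂μ = ∫ x, f x ∂μ := by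
      rw [← hR.integral_comp hRe f]
      exact integral_congr_ae (ae_of_all _ fun x => (hfg x).symm)
    have h2 : ∫ x, f x ∂μ + ∫ x, g x ∂μ ≤ 0 := by
      rw [← integral_add hfi hgi]
      exact integral_nonpos hsum
    linarith
  · rw [integral_undef hfi]

/-- `n₋ + n₊ ≤ 12 S⁴` for the Hermitian Wilson–Dirac characteristic roots. -/
theorem negCount_add_posCount_le {S : ℕ} [NeZero S] (U : GaugeConfig 4 S SU3) (m' : ℝ) :
    ((spinorLift gammaFive * wilsonDirac (fundamentalRep (Fin 3)) U m' 1).charpoly.roots.countP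
        fun z : ℂ => z.re < 0) +
      ((spinorLift gammaFive * wilsonDirac (fundamentalRep (Fin 3)) U m' 1).charpoly.roots.countP
        fun z : ℂ => 0 < z.re) ≤ 12 * S ^ 4 := by
  set s := (spinorLift gammaFive * wilsonDirac (fundamentalRep (Fin 3)) U m' 1).charpoly.roots with hs
  have h1 : (s.countP fun z : ℂ => z.re < 0) + (s.countP fun z : ℂ => 0 < z.re) ≤ Multiset.card s := by
    rw [Multiset.countP_eq_card_filter, Multiset.countP_eq_card_filter, ← Multiset.card_add,
      Multiset.filter_add_filter]
    have h0 : Multiset.filter (fun a : ℂ => a.re < 0 ∧ 0 < a.re) s = 0 :=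
      Multiset.filter_eq_nil.mpr fun a _ h => by linarith [h.1, h.2]
    rw [h0, add_zero]
    exact Multiset.card_le_card (Multiset.filter_le _ _)
  refine h1.trans ((Polynomial.card_roots' _).trans ?_)
  rw [Matrix.charpoly_natDegree_eq_dim, card_quarkIdx]

/-- **`E₊[n₋ − n/2] ≤ 0`.**  For every torus side `S`, coupling `β`, probe mass `m'`, and every
family of weight masses `mq`: the phase-quenched (un-normalised) mean of the SIGNED index
`n₋(Γ₅ D_W(U, m', 1)) − 6S⁴` against the weight `∏_f |det D_W(U, mq_f, 1)|` is `≤ 0`.  Proof: the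
time reflection `Θ'` preserves the Wilson measure (`measurePreserving_negReflect_wilsonMeasure`) and the weight
(`det_wilsonDirac_negReflect`) and maps `n₋` to `n₊` (`negCount_hermitianWilson_negReflect`); since
`n₋ + n₊ ≤ 12 S⁴`, the mean of `n₋ − 6S⁴` equals the mean of `n₊ − 6S⁴` and their sum is `≤ 0`. -/
theorem signedIndex_integral_nonpos {Nf : ℕ} (S : ℕ) [NeZero S] (β m' : ℝ) (mq : Fin Nf → ℝ) :
    ∫ U, ((Multiset.countP (fun z : ℂ => z.re < 0) (spinorLift gammaFive *
        wilsonDirac (fundamentalRep (Fin 3)) U m' 1).charpoly.roots : ℝ) - 6 * (S : ℝ) ^ 4) *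
        ∏ f : Fin Nf, ‖fermionDet (wilsonDirac (fundamentalRep (Fin 3)) U (mq f) 1)‖
      ∂(wilsonMeasure (d := 4) (L := S) (fundamentalRep (Fin 3)) β) ≤ 0 := by
  have hρ3 : ∀ g, fundamentalRep (Fin 3) g ∈ Matrix.unitaryGroup (Fin 3) ℂ :=
    fundamentalRep_mem_unitaryGroup
  have hmp : MeasurePreserving (GaugeConfig.negReflect : GaugeConfig 4 S SU3 → GaugeConfig 4 S SU3)
      (wilsonMeasure (d := 4) (L := S) (fundamentalRep (Fin 3)) β)
      (wilsonMeasure (d := 4) (L := S) (fundamentalRep (Fin 3)) β) :=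
    measurePreserving_negReflect_wilsonMeasure (fundamentalRep (Fin 3)) (continuous_fundamentalRep (Fin 3)) β
  have hemb : MeasurableEmbedding (GaugeConfig.negReflect : GaugeConfig 4 S SU3 → GaugeConfig 4 S SU3) :=
    (WilsonSiteRP.negReflectEquiv (d := 4) (L := S) (G := SU3)).measurableEmbedding
  refine integral_nonpos_of_reflection hmp hemb _
    (fun U => ((Multiset.countP (fun z : ℂ => 0 < z.re) (spinorLift gammaFive *
        wilsonDirac (fundamentalRep (Fin 3)) U m' 1).charpoly.roots : ℝ) - 6 * (S : ℝ) ^ 4) *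
        ∏ f : Fin Nf, ‖fermionDet (wilsonDirac (fundamentalRep (Fin 3)) U (mq f) 1)‖)
    (fun U => ?_) (fun U => ?_)
  · -- the reflection exchanges `n₋` and `n₊` and fixes the weight
    rw [negCount_hermitianWilson_negReflect (fundamentalRep (Fin 3)) hρ3 U m']
    congr 1
    refine Finset.prod_congr rfl fun i _ => ?_
    rw [fermionDet, fermionDet, det_wilsonDirac_negReflect (fundamentalRep (Fin 3)) hρ3 U]
  · -- `f + g = (n₋ + n₊ − 12 S⁴) w ≤ 0`
    have hw0 : 0 ≤ ∏ f : Fin Nf, ‖fermionDet (wilsonDirac (fundamentalRep (Fin 3)) U (mq f) 1)‖ :=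
      Finset.prod_nonneg fun i _ => norm_nonneg _
    have hc := negCount_add_posCount_le U m'
    have hc' : (Multiset.countP (fun z : ℂ => z.re < 0) (spinorLift gammaFive *
        wilsonDirac (fundamentalRep (Fin 3)) U m' 1).charpoly.roots : ℝ) +
        (Multiset.countP (fun z : ℂ => 0 < z.re) (spinorLift gammaFive *
          wilsonDirac (fundamentalRep (Fin 3)) U m' 1).charpoly.roots : ℝ) ≤ 12 * (S : ℝ) ^ 4 := by
      exact_mod_cast hc
    rw [← add_mul]
    exact mul_nonpos_of_nonpos_of_nonneg (by linarith) hw0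

/-- **SIGNED TIGHT IS FALSE FOR EVERY WITNESS.**  The natural strengthening of the TIGHT clause of
`WindowExtinction` obtained by dropping the absolute value — "the phase-quenched expectation of the
signed index `n₋(Γ₅ D_W(U, m_crit(k) − a_k M/Z_m(k), 1)) − 6(2L_k+1)⁴` is `≥ 1`" — fails at EVERY step
`k`, for every regularisation, mass tuple and probe: that expectation is `≤ 0` by the time-reflection
symmetry of the Wilson measure and of the weights, which reverses the index.  Hence the `|·|` in TIGHT
is essential: TIGHT is an ANTI-CONCENTRATION statement about a reflection-antisymmetric integer
fluctuation (mean `≤ 0`, mean modulus required `≥ 1`), not a statement about a mean. -/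
theorem signedTight_false {Nf : ℕ} (reg : QCDRegularisation Nf) (m : Fin Nf → ℝ) (M : ℝ) (k : ℕ) :
    ¬ (1 ≤ (∫ U, ((Multiset.countP (fun z : ℂ => z.re < 0) (spinorLift gammaFive * wilsonDirac (fundamentalRep (Fin 3)) U (reg.mcrit k - reg.a k * M / reg.Zm k) 1).charpoly.roots : ℝ) - 6 * (2 * reg.L k + 1 : ℝ) ^ 4) * ∏ f : Fin Nf, ‖fermionDet (wilsonDirac (fundamentalRep (Fin 3)) U (reg.mcrit k + reg.a k * m f / reg.Zm k) 1)‖ ∂(wilsonMeasure (d := 4) (L := 2 * reg.L k + 1) (fundamentalRep (Fin 3)) (reg.β k))) / (∫ U, ∏ f : Fin Nf, ‖fermionDet (wilsonDirac (fundamentalRep (Fin 3)) U (reg.mcrit k + reg.a k * m f / reg.Zm k) 1)‖ ∂(wilsonMeasure (d := 4) (L := 2 * reg.L k + 1) (fundamentalRep (Fin 3)) (reg.β k)))) := by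
  have hnum := signedIndex_integral_nonpos (Nf := Nf) (2 * reg.L k + 1) (reg.β k)
    (reg.mcrit k - reg.a k * M / reg.Zm k) (fun f => reg.mcrit k + reg.a k * m f / reg.Zm k)
  have hden : 0 ≤ ∫ U, ∏ f : Fin Nf, ‖fermionDet (wilsonDirac (fundamentalRep (Fin 3)) U
      (reg.mcrit k + reg.a k * m f / reg.Zm k) 1)‖
        ∂(wilsonMeasure (d := 4) (L := 2 * reg.L k + 1) (fundamentalRep (Fin 3)) (reg.β k)) :=
    integral_nonneg fun U => Finset.prod_nonneg fun i _ => norm_nonneg _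
  have hcast : ((2 * reg.L k + 1 : ℕ) : ℝ) = 2 * reg.L k + 1 := by push_cast; ring
  rw [hcast] at hnum
  have hle := div_nonpos_iff.mpr (Or.inr ⟨hnum, hden⟩)
  linarith

end SignedTight

end Summit.QuantumFields.QCD.Theorems.TipPricing.Negative

end
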